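import Summits.AtomisticToContinuum.Crystallization.Theorems.CoarseGrains.Negative.PredicateAPI
import Summits.AtomisticToContinuum.Crystallization.Theorems.CoarseGrains.Negative.VacuityThreshold

/-!
# `FineGrains` / Negative: the fcc obstruction — no subset of a (relaxed, moved) fcc stacking has a fine ball

Negative knowledge for crux `stmt-AtomisticToContinuum-9330` (`ExcessDecayLiouville.FineGrains`),
standing crux-disprover seat `refuter-cdisprove-stmt-AtomisticToContinuum-9330-0` (2026-08-16).  The
route's kill criterion made kernel-checked: the matrix of `FineGrains` FAILS, at radius `ρ ≥ 3` and
tolerance `ε ≤ 1/100`, on EVERY configuration contained in an isometric image of a relaxed fcc stacking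
`fccStacking a h` with `a ∈ [0.96, 0.99]`, `h ∈ [0.78, 0.81]` (this box contains the relaxed
Lennard-Jones fcc cell `a ≈ 0.9713`, `h = a√(2/3) ≈ 0.7931`) — WHATEVER the free sublattice offset
`t 1 − t 0` of the datum.  So `FineGrains` is false as soon as, for some fixed scale, infinitely many
Lennard-Jones ground states are fcc-grained (BlancLewin2015 §2.3 leaves hcp vs fcc open; the static
lattice sums favour hcp by `7.25·10⁻⁵` per particle, Stillinger2001).  Nothing here closes an item; no
theorem concludes a Theses decl; the hypothesis "ground states are fcc pieces" is NOT filed as a wanted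
construction (it is believed false) — the lemma records the obstruction only.

* `fcc_dist_sq_dichotomy`: squared distances in `fccStacking a h` are `≤ 199/100` or `≥ 137/50`
  (`= a²(p² + pq + q² + pm + qm + m²/3) + m²h²` over `ℤ³`; case analysis on the layer difference `m`).
* `not_near_of_locally_fcc` / `not_near_of_subset_fcc`: for `Adm A`, `ρ ≥ 3`, `ε ≤ 1/100` and
  `X ∩ B_ρ(c) ⊆ f '' fccStacking a h` (resp. `X ⊆ …`; `f` an isometry), `¬ Near X c ρ t A ε`: the sites
  `t 0 + A z` and `t 0 + A (z + 2√(2/3)e₃)` lie in the ball and own two points of `X ∩ B_ρ(c)` at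
  distance within `2ε` of `‖A(2√(2/3)e₃)‖ ∈ [1.5431, 1.6249]`, i.e. of squared distance in
  `(1.99, 2.74)` — excluded by the dichotomy; `fineGrains_matrix_fails_on_fcc` (configurations).
* Companion file `FccObstructionCoarse`: the same at the COARSE tolerance `ε ≤ 1/40` of the sibling crux
  `CoarseGrains` (stmt-9331), for fcc cells within `±0.4 %` of the relaxed one.
-/

noncomputable section

open Literature.MathematicalPhysics.StatisticalMechanics

namespace Summit.AtomisticToContinuum.Crystallization.Theorems.FineGrains.Negative.FccObstruction

open Summit.AtomisticToContinuum.Crystallization.Theorems.CoarseGrains.Negative.PredicateAPI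
open Summit.AtomisticToContinuum.Crystallization.Theorems.CoarseGrains.Negative.VacuityThreshold

/-! ### Integer quadratic forms (companions of `VacuityThreshold.int_quad_nonneg₁/₂`) -/

/-- `p² + pq + q² − 2p − 2q + 1 ≥ 0` on `ℤ²`. [folklore] -/
theorem int_quad_nonneg_sub₂ (p q : ℤ) : 0 ≤ p * p + p * q + q * q - 2 * p - 2 * q + 1 := by
  have h := int_quad_nonneg₂ (-p) (-q)
  nlinarith [h]

/-- `p² + pq + q² ∈ {0, 1} ∪ [3, ∞)` on `ℤ²` (the value `2` is not represented). [folklore] -/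
theorem int_quad_le_one_or_three_le (p q : ℤ) :
    p * p + p * q + q * q ≤ 1 ∨ 3 ≤ p * p + p * q + q * q := by
  by_contra hcon
  push Not at hcon
  obtain ⟨h1, h2⟩ := hcon
  have h3 : p * p + p * q + q * q = 2 := by omega
  -- `4·2 = (2p+q)² + 3q²` forces `q² ≤ 2`, then contradiction by cases
  have hq : q * q ≤ 2 := by nlinarith [sq_nonneg (2 * p + q)]
  have hq' : -1 ≤ q ∧ q ≤ 1 := by
    constructor <;> nlinarith [sq_nonneg (q + 1), sq_nonneg (q - 1)]
  have hp : p * p ≤ 3 := by nlinarith [sq_nonneg (2 * q + p)]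
  have hp' : -1 ≤ p ∧ p ≤ 1 := by
    constructor <;> nlinarith [sq_nonneg (p + 1), sq_nonneg (p - 1)]
  obtain ⟨hq1, hq2⟩ := hq'
  obtain ⟨hp1, hp2⟩ := hp'
  interval_cases p <;> interval_cases q <;> omega

/-! ### Squared distances in a relaxed fcc stacking avoid `(1.99, 2.74)` -/

/-- Real core of the dichotomy: `D² = a²(N + M²/3) + M²h²` with the integer side conditions of the
four layer-difference cases. [folklore] -/
theorem dichotomy_core {a h N MM : ℝ} (ha2 : (24 / 25 : ℝ) ^ 2 ≤ a ^ 2) (ha2' : a ^ 2 ≤ (99 / 100) ^ 2)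
    (hh2 : (39 / 50 : ℝ) ^ 2 ≤ h ^ 2) (hh2' : h ^ 2 ≤ (81 / 100) ^ 2)
    (hcase : (MM = 0 ∧ 0 ≤ N ∧ (N ≤ 1 ∨ 3 ≤ N)) ∨ (MM = 1 ∧ 0 ≤ N ∧ (N ≤ 1 ∨ 2 ≤ N)) ∨
      (MM = 4 ∧ -1 ≤ N) ∨ (9 ≤ MM ∧ 0 ≤ N + MM / 3)) :
    a ^ 2 * (N + MM / 3) + MM * h ^ 2 ≤ 199 / 100 ∨ 137 / 50 ≤ a ^ 2 * (N + MM / 3) + MM * h ^ 2 := by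
  have ha0 : 0 ≤ a ^ 2 := sq_nonneg a
  have hh0 : 0 ≤ h ^ 2 := sq_nonneg h
  rcases hcase with ⟨hM, hN0, hN | hN⟩ | ⟨hM, hN0, hN | hN⟩ | ⟨hM, hN⟩ | ⟨hM, hN⟩
  · left; rw [hM]
    nlinarith [mul_le_mul_of_nonneg_left hN ha0]
  · right; rw [hM]
    nlinarith [mul_le_mul_of_nonneg_left hN ha0]
  · left; rw [hM]
    nlinarith [mul_le_mul_of_nonneg_left hN ha0]
  · right; rw [hM]
    nlinarith [mul_le_mul_of_nonneg_left hN ha0]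
  · right; rw [hM]
    nlinarith [mul_le_mul_of_nonneg_left hN ha0]
  · right
    have h1 : 0 ≤ a ^ 2 * (N + MM / 3) := mul_nonneg ha0 hN
    have h2 : 9 * (39 / 50 : ℝ) ^ 2 ≤ MM * h ^ 2 := by nlinarith [mul_le_mul_of_nonneg_left hh2 (by linarith : (0:ℝ) ≤ MM)]
    nlinarith

/-- **Dichotomy of fcc distances.** For `a ∈ [0.96, 0.99]`, `h ∈ [0.78, 0.81]`, two points of
`fccStacking a h` are at squared distance `≤ 199/100` or `≥ 137/50`: with `p = i − i'`, `q = j − j'`,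
`m = k − k'` the squared distance is `a²(p² + pq + q² + pm + qm + m²/3) + m²h²`; `|m| ≥ 3` gives
`≥ 9h²`, `m = 0` gives `a²·{0, 1}` or `≥ 3a²`, `m = ±1` gives `a²/3 + h²`, `4a²/3 + h²` or `≥ 7a²/3 + h²`,
`m = ±2` gives `≥ a²/3 + 4h² ≥ 2.7408`. [folklore] -/
theorem fcc_dist_sq_dichotomy {a h : ℝ} (ha : 24 / 25 ≤ a) (ha' : a ≤ 99 / 100) (hh : 39 / 50 ≤ h)
    (hh' : h ≤ 81 / 100) (k i j k' i' j' : ℤ) :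
    dist (barlowPos a h constHagg k i j) (barlowPos a h constHagg k' i' j') ^ 2 ≤ 199 / 100 ∨
    137 / 50 ≤ dist (barlowPos a h constHagg k i j) (barlowPos a h constHagg k' i' j') ^ 2 := by
  rw [dist_barlowPos_sq]
  simp only [haggLabel_const]
  have h3 : (Real.sqrt 3) ^ 2 = 3 := Real.sq_sqrt (by norm_num)
  -- name the integer differences
  obtain ⟨p, hp⟩ : ∃ p : ℤ, ((i : ℝ) - i') = p := ⟨i - i', by push_cast; ring⟩
  obtain ⟨q, hq⟩ : ∃ q : ℤ, ((j : ℝ) - j') = q := ⟨j - j', by push_cast; ring⟩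
  obtain ⟨m, hm⟩ : ∃ m : ℤ, ((k : ℝ) - k') = m := ⟨k - k', by push_cast; ring⟩
  rw [hp, hq, hm]
  have key : (a * ((p : ℝ) + (q : ℝ) / 2 + (m : ℝ) / 2)) ^ 2 +
      (a * Real.sqrt 3 / 2 * ((q : ℝ) + (m : ℝ) / 3)) ^ 2 + ((m : ℝ) * h) ^ 2 =
      a ^ 2 * (((p : ℝ) * p + p * q + q * q + p * m + q * m) + ((m : ℝ) * m) / 3) +
        ((m : ℝ) * m) * h ^ 2 := by
    linear_combination (a ^ 2 * ((q : ℝ) + (m : ℝ) / 3) ^ 2 / 4) * h3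
  rw [key]
  have ha2 : (24 / 25 : ℝ) ^ 2 ≤ a ^ 2 := pow_le_pow_left₀ (by norm_num) ha 2
  have ha2' : a ^ 2 ≤ (99 / 100 : ℝ) ^ 2 := pow_le_pow_left₀ (by linarith) ha' 2
  have hh2 : (39 / 50 : ℝ) ^ 2 ≤ h ^ 2 := pow_le_pow_left₀ (by norm_num) hh 2
  have hh2' : h ^ 2 ≤ (81 / 100 : ℝ) ^ 2 := pow_le_pow_left₀ (by linarith) hh' 2
  refine dichotomy_core ha2 ha2' hh2 hh2' ?_
  -- the integer side conditions
  rcases le_or_gt 3 |m| with hm3 | hm3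
  · -- |m| ≥ 3
    refine Or.inr (Or.inr (Or.inr ⟨?_, ?_⟩))
    · have : (9 : ℤ) ≤ m * m := by
        rcases abs_cases m with ⟨habs, _⟩ | ⟨habs, _⟩ <;> nlinarith
      exact_mod_cast this
    · have hFid : (p : ℝ) * p + p * q + q * q + p * m + q * m + (m : ℝ) * m / 3 =
          ((p : ℝ) + q / 2 + m / 2) ^ 2 + 3 / 4 * ((q : ℝ) + m / 3) ^ 2 := by ring
      rw [hFid]; positivity
  · have hmcases : m = 0 ∨ m = 1 ∨ m = -1 ∨ m = 2 ∨ m = -2 := by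
      rcases abs_cases m with ⟨habs, _⟩ | ⟨habs, _⟩ <;> omega
    rcases hmcases with h0 | h1 | h1' | h2 | h2'
    · -- m = 0
      subst h0
      refine Or.inl ⟨by norm_num, ?_, ?_⟩
      · have h0' : (0 : ℤ) ≤ p * p + p * q + q * q := by nlinarith [sq_nonneg (2 * p + q), sq_nonneg q]
        have : (0 : ℝ) ≤ (p : ℝ) * p + p * q + q * q := by exact_mod_cast h0'
        push_cast; linarith
      · rcases int_quad_le_one_or_three_le p q with hle | hge
        · left
          have : (p : ℝ) * p + p * q + q * q ≤ 1 := by exact_mod_cast hle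
          push_cast; linarith
        · right
          have : (3 : ℝ) ≤ (p : ℝ) * p + p * q + q * q := by exact_mod_cast hge
          push_cast; linarith
    · -- m = 1
      subst h1
      refine Or.inr (Or.inl ⟨by norm_num, ?_, ?_⟩)
      · have : (0 : ℝ) ≤ (p : ℝ) * p + p * q + q * q + p + q := by exact_mod_cast int_quad_nonneg₁ p q
        push_cast; linarith
      · rcases le_or_gt (p * p + p * q + q * q + p + q) 1 with hle | hge
        · left
          have : (p : ℝ) * p + p * q + q * q + p + q ≤ 1 := by exact_mod_cast hle
          push_cast; linarith
        · right
          have : (2 : ℝ) ≤ (p : ℝ) * p + p * q + q * q + p + q := by exact_mod_cast hge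
          push_cast; linarith
    · -- m = -1
      subst h1'
      refine Or.inr (Or.inl ⟨by norm_num, ?_, ?_⟩)
      · have : (0 : ℝ) ≤ (p : ℝ) * p + p * q + q * q - p - q := by
          have hq3 : (0 : ℤ) ≤ p * p + p * q + q * q - p - q := by
            have h := int_quad_nonneg₁ (-p) (-q); nlinarith [h]
          exact_mod_cast hq3
        push_cast; linarith
      · rcases le_or_gt (p * p + p * q + q * q - p - q) 1 with hle | hge
        · left
          have : (p : ℝ) * p + p * q + q * q - p - q ≤ 1 := by exact_mod_cast hle
          push_cast; linarith
        · right
          have : (2 : ℝ) ≤ (p : ℝ) * p + p * q + q * q - p - q := by exact_mod_cast hge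
          push_cast; linarith
    · -- m = 2
      subst h2
      refine Or.inr (Or.inr (Or.inl ⟨by norm_num, ?_⟩))
      have : (0 : ℝ) ≤ (p : ℝ) * p + p * q + q * q + 2 * p + 2 * q + 1 := by
        exact_mod_cast int_quad_nonneg₂ p q
      push_cast; linarith
    · -- m = -2
      subst h2'
      refine Or.inr (Or.inr (Or.inl ⟨by norm_num, ?_⟩))
      have : (0 : ℝ) ≤ (p : ℝ) * p + p * q + q * q - 2 * p - 2 * q + 1 := by
        exact_mod_cast int_quad_nonneg_sub₂ p q
      push_cast; linarith

/-! ### The obstruction: no subset of a moved relaxed fcc stacking has a fine ball -/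

/-- `‖2√(2/3)e₃‖² = 8/3`. [folklore] -/
theorem norm_layerPeriod_sq : ‖(layerNormal (2 * Real.sqrt (2 / 3)) : E3)‖ ^ 2 = 8 / 3 := by
  have h := lam_norm_sq 0 0 1
  simpa using h

/-- **The fcc obstruction (local form).** If the part of `X` in the closed ball `B_ρ(c)`, `ρ ≥ 3`, is
contained in an isometric image of `fccStacking a h` with `a ∈ [0.96, 0.99]`, `h ∈ [0.78, 0.81]`, then NO
admissible datum two-way `ε`-matches `X` on `B_ρ(c)` for `ε ≤ 1/100` — whatever the sublattice offsets
`t`: the sites `t 0 + A z` (within `11/10` of `c`) and `t 0 + A (z + 2√(2/3)e₃)` lie in the ball and own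
two points of `X ∩ B_ρ(c)` whose distance is within `2ε` of `‖A(2√(2/3)e₃)‖ ∈ [1.5431, 1.6249]`, hence
has square in `(1.99, 2.74)` — excluded by `fcc_dist_sq_dichotomy`. [folklore] -/
theorem not_near_of_locally_fcc {a h : ℝ} (ha : 24 / 25 ≤ a) (ha' : a ≤ 99 / 100) (hh : 39 / 50 ≤ h)
    (hh' : h ≤ 81 / 100) {X : Set E3} {f : E3 → E3} (hf : Isometry f) {c : E3} {ρ : ℝ} (hρ : 3 ≤ ρ)
    (hX : ∀ p ∈ X, dist p c ≤ ρ → p ∈ f '' fccStacking a h) {t : Fin 2 → E3} {A : E3 →L[ℝ] E3}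
    (hA : Adm A) {ε : ℝ} (hε : ε ≤ 1 / 100) : ¬ Near X c ρ t A ε := by
  intro hN
  set ℓ : E3 := layerNormal (2 * Real.sqrt (2 / 3)) with hℓ
  have hℓmem : ℓ ∈ Lam := ⟨0, 0, 1, by simp [hℓ]⟩
  have hℓsq : ‖ℓ‖ ^ 2 = 8 / 3 := norm_layerPeriod_sq
  have hℓle : ‖ℓ‖ ≤ 1633 / 1000 := by nlinarith [norm_nonneg ℓ]
  have hℓge : 163299 / 100000 ≤ ‖ℓ‖ := by nlinarith [norm_nonneg ℓ]
  have hLle : ‖A ℓ‖ ≤ 199 / 200 * (1633 / 1000) := by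
    have := adm_norm_le hA ℓ
    linarith
  have hLge : 189 / 200 * (163299 / 100000) ≤ ‖A ℓ‖ := by
    have := adm_le_norm hA ℓ
    linarith
  -- the two sites
  obtain ⟨z, hz, hzc⟩ := exists_site_near hA (t 0) c
  have hzℓ : z + ℓ ∈ Lam := lam_add_mem hz hℓmem
  have hd : dist (t 0 + A (z + ℓ)) (t 0 + A z) = ‖A ℓ‖ := by
    rw [dist_site_site]; congr 1; abel_nf
  have hzℓc : dist (t 0 + A (z + ℓ)) c ≤ 2725 / 1000 := by
    calc dist (t 0 + A (z + ℓ)) c ≤ dist (t 0 + A (z + ℓ)) (t 0 + A z) + dist (t 0 + A z) c :=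
          dist_triangle _ _ _
      _ ≤ 199 / 200 * (1633 / 1000) + 11 / 10 := by rw [hd]; linarith
      _ ≤ 2725 / 1000 := by norm_num
  obtain ⟨p0, hp0, hp0d⟩ := hN.2 0 z hz (by linarith)
  obtain ⟨p3, hp3, hp3d⟩ := hN.2 0 (z + ℓ) hzℓ (by linarith)
  have hε0 : 0 ≤ ε := le_trans dist_nonneg hp0d
  -- both owned points lie in the ball, hence are images of fcc points
  have hp0c : dist p0 c ≤ ρ := by
    calc dist p0 c ≤ dist p0 (t 0 + A z) + dist (t 0 + A z) c := dist_triangle _ _ _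
      _ ≤ ε + 11 / 10 := by gcongr
      _ ≤ ρ := by linarith
  have hp3c : dist p3 c ≤ ρ := by
    calc dist p3 c ≤ dist p3 (t 0 + A (z + ℓ)) + dist (t 0 + A (z + ℓ)) c := dist_triangle _ _ _
      _ ≤ ε + 2725 / 1000 := by gcongr
      _ ≤ ρ := by linarith
  obtain ⟨y0, hy0, rfl⟩ := hX p0 hp0 hp0c
  obtain ⟨y3, hy3, rfl⟩ := hX p3 hp3 hp3c
  have hy0' : ∃ k i j : ℤ, y0 = barlowPos a h constHagg k i j := hy0
  have hy3' : ∃ k i j : ℤ, y3 = barlowPos a h constHagg k i j := hy3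
  obtain ⟨k, i, j, rfl⟩ := hy0'
  obtain ⟨k', i', j', rfl⟩ := hy3'
  have hD := hf.dist_eq (barlowPos a h constHagg k i j) (barlowPos a h constHagg k' i' j')
  -- |D - L| ≤ 2ε by two triangle inequalities
  have hup : dist (f (barlowPos a h constHagg k i j)) (f (barlowPos a h constHagg k' i' j')) ≤
      ε + ‖A ℓ‖ + ε := by
    calc _ ≤ dist (f (barlowPos a h constHagg k i j)) (t 0 + A z) + dist (t 0 + A z) (t 0 + A (z + ℓ))
          + dist (t 0 + A (z + ℓ)) (f (barlowPos a h constHagg k' i' j')) := dist_triangle4 _ _ _ _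
      _ ≤ ε + ‖A ℓ‖ + ε := by
        gcongr
        · rw [dist_comm, hd]
        · rw [dist_comm]; exact hp3d
  have hlow : ‖A ℓ‖ ≤ ε + dist (f (barlowPos a h constHagg k i j)) (f (barlowPos a h constHagg k' i' j'))
      + ε := by
    calc ‖A ℓ‖ = dist (t 0 + A z) (t 0 + A (z + ℓ)) := by rw [dist_comm, hd]
      _ ≤ dist (t 0 + A z) (f (barlowPos a h constHagg k i j)) +
          dist (f (barlowPos a h constHagg k i j)) (f (barlowPos a h constHagg k' i' j')) +
          dist (f (barlowPos a h constHagg k' i' j')) (t 0 + A (z + ℓ)) := dist_triangle4 _ _ _ _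
      _ ≤ ε + dist (f (barlowPos a h constHagg k i j)) (f (barlowPos a h constHagg k' i' j')) + ε := by
        gcongr
        · rw [dist_comm]; exact hp0d
  rw [hD] at hup hlow
  have hD0 : 0 ≤ dist (barlowPos a h constHagg k i j) (barlowPos a h constHagg k' i' j') := dist_nonneg
  rcases fcc_dist_sq_dichotomy ha ha' hh hh' k i j k' i' j' with hsmall | hbig
  · have h1 : (1523 / 1000 : ℝ) ≤ dist (barlowPos a h constHagg k i j) (barlowPos a h constHagg k' i' j') := by
      linarith
    nlinarith
  · have h1 : dist (barlowPos a h constHagg k i j) (barlowPos a h constHagg k' i' j') ≤ 1645 / 1000 := by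
      linarith
    nlinarith

/-- **The fcc obstruction (global form).** A subset of an isometric image of `fccStacking a h`
(`a ∈ [0.96, 0.99]`, `h ∈ [0.78, 0.81]`; finite, infinite or empty) has no two-way `ε`-matched
admissible ball of radius `ρ ≥ 3` for `ε ≤ 1/100`. [folklore] -/
theorem not_near_of_subset_fcc {a h : ℝ} (ha : 24 / 25 ≤ a) (ha' : a ≤ 99 / 100) (hh : 39 / 50 ≤ h)
    (hh' : h ≤ 81 / 100) {X : Set E3} {f : E3 → E3} (hf : Isometry f)
    (hX : X ⊆ f '' fccStacking a h) {c : E3} {t : Fin 2 → E3} {A : E3 →L[ℝ] E3} (hA : Adm A)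
    {ρ ε : ℝ} (hρ : 3 ≤ ρ) (hε : ε ≤ 1 / 100) : ¬ Near X c ρ t A ε :=
  not_near_of_locally_fcc ha ha' hh hh' hf hρ (fun _ hp _ => hX hp) hA hε

/-- **The matrix of `FineGrains` fails on every fcc piece:** a configuration whose particles lie in an
isometric image of `fccStacking a h` (`a ∈ [0.96, 0.99]`, `h ∈ [0.78, 0.81]`) has no fine ball of radius
`ρ ≥ 3` at tolerance `ε ≤ 1/100`, for any `N`.  So `FineGrains` is false as soon as, for infinitely many
`N`, some Lennard-Jones ground state is such a piece (the route's kill criterion; believed not to be the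
case: the static lattice sums favour hcp). [folklore] -/
theorem fineGrains_matrix_fails_on_fcc {a h : ℝ} (ha : 24 / 25 ≤ a) (ha' : a ≤ 99 / 100)
    (hh : 39 / 50 ≤ h) (hh' : h ≤ 81 / 100) {N : ℕ} {x : Fin N → E3} {f : E3 → E3} (hf : Isometry f)
    (hx : Set.range x ⊆ f '' fccStacking a h) {ρ ε : ℝ} (hρ : 3 ≤ ρ) (hε : ε ≤ 1 / 100) :
    ¬ ∃ (c : E3) (t : Fin 2 → E3) (A : E3 →L[ℝ] E3), Adm A ∧ Near (Set.range x) c ρ t A ε := by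
  rintro ⟨c, t, A, hA, hN⟩
  exact not_near_of_subset_fcc ha ha' hh hh' hf hx hA hρ hε hN

end Summit.AtomisticToContinuum.Crystallization.Theorems.FineGrains.Negative.FccObstruction

end
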